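import Literature.AlgebraicGeometry.KTheory.HuInfinitesimalKZero
import HarnessLib

/-!
# X. Hu's infinitesimal `K₀` facts — proved companions (functoriality of the level reductions)

Sibling of `KTheory/HuInfinitesimalKZero` (the two `@[claim]` named facts `HuKZeroLiftingCriterion`,
`HuKZeroKernelPresentation` vendoring X. Hu, arXiv:2507.12458, Thm. 1.2 / Cor. 10.5(i)). This file holds
what is PROVED around them on the tree's carriers; it introduces no definitions and no named facts.

## Contents

* Functoriality of the level reductions that clause (b) of both facts is phrased with: the maps
  `HuObstructionTarget.reduce d m (h : n ≤ n')` and `HuKernelSource.reduce m h` form inverse systems in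
  `n` — `reduce (le_refl n) = id` (`HuObstructionTarget.reduce_refl`, `HuKernelSource.reduce_refl`) and
  `reduce h ∘ reduce h' = reduce (h.trans h')` (`….reduce_comp`) — which is what a consumer needs to
  pass from the level-wise statements to `lim_n` (Bloch–Esnault–Kerz-style arguments). Proved bottom-up
  from the functoriality of staircase reductions (`Algebra.Homology.powQuotientMap_refl` /
  `powQuotientMap_comp`) and of push-forwards of staircase images (checked after the degreewise-mono
  inclusion `powImageι`; cf. `Algebra.Homology.powImageMap_id` / `powImageMap_comp` in
  `Algebra/Homology/StaircasePresentation`): Hu's reductions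
  `p^{r,M}_{r,N'}Ω• → p^{r,M}_{r,N}Ω•` are functorial (`huComplexReduce_refl/comp`, `huComplexIntReduce_refl/comp`, over
  `Crystalline/HuComplexes`), hence so are the induced maps on hypercohomology
  (`huHReduce_refl/comp`).
* The long exact hypercohomology sequence of X. Hu's three-term sequences
  `0 → p^{r,M}_{r,N}Ω• → p^{r,M'}_{r,N}Ω• → p^{r,M'}_{r,M}Ω• → 0` (`M' ≤ M ≤ N`, arXiv:2507.12458 §8;
  `Crystalline.huShortComplex`, `Crystalline.hu_shortExact`): the sequence stays short exact after
  extension by zero to `ℤ`-indexed complexes (`hu_shortExact_extend`), whence the exact sequence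
  `ℍⁱ(p^{r,M}_{r,N}) → ℍⁱ(p^{r,M'}_{r,N}) → ℍⁱ(p^{r,M'}_{r,M}) →δ ℍⁱ⁺¹(p^{r,M}_{r,N}) → ℍⁱ⁺¹(p^{r,M'}_{r,N})`
  on `huH` (`huH_exact₂`, `huH_exact₃`, `huH_exact₁`, via `Algebra.Homology.HyperExt`; in particular
  the reduction `ℍ^{n₀}(p^{r,M'}_{r,N}) → ℍ^{n₀}(p^{r,M'}_{r,M})` is onto iff `δ = 0`, iff
  `ℍ^{n₀+1}(p^{r,M}_{r,N}) → ℍ^{n₀+1}(p^{r,M'}_{r,N})` is injective —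
  `huHReduce_surjective_iff_delta_eq_zero`, `huHReduce_surjective_iff_map_injective`), the
  compatibility of its connecting maps with the reductions in `N` (`huHδ_naturality`), and the
  vanishing of `ℍⁱ(p^{r,M}_{r,N})` outside `[0, (r − 1) + c]` on a space of cohomological dimension
  `≤ c` (`huH_eq_zero_of_lt`, `huH_eq_zero_of_neg`). For `M' = 1`
  this is the de Rham side of the fundamental triangle (8.5) (Def. 8.3: `p^{r,m}_{r,n}Ω•` is the
  fibre of `p(r)Ω•_{X_n} → p(r)Ω•_{X_m}`), i.e. the bottom row of the diagram in the proof of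
  Prop. 11.1, and its naturality in `n` is the de Rham half of clause (b) of the facts.

## On discharging the facts themselves

`HuKZeroLiftingCriterion_holds` / `HuKZeroKernelPresentation_holds` are NOT here: the printed proof
(Brun's isomorphism `K_i(R,I;p) ≅ HC̃_{i-1}(R,I;p)`, derived cyclic homology of smooth
`W_n(k)`-algebras, infinitesimal motivic complexes `ℤ_{X_n}(r)`, Gillet–Totaro Chern classes,
Thomason–Trobaugh descent, Bass delooping; arXiv:2507.12458 §§3–11) rests on theories with no
counterpart in Mathlib or this tree (higher / relative algebraic `K`-theory, Hochschild and cyclic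
homology, de Rham–Witt and motivic complexes). [folklore]
-/

noncomputable section

namespace Literature.AlgebraicGeometry.KTheory

open CategoryTheory _root_.AlgebraicGeometry _root_.TopologicalSpace
  Literature.AlgebraicGeometry.Motives Literature.AlgebraicGeometry.Crystalline
  Literature.Algebra.Homology

/-! ### Functoriality of the level reductions -/

section Functoriality

universe u

section Complexes

variable {A : Type u} [CommRing A] (X : Over (Spec (CommRingCat.of A))) (q : ℤ)

/-- Hu's reduction `p^{r,M}_{r,N}Ω• → p^{r,M}_{r,N}Ω•` for `N ≤ N` is the identity. [folklore] -/
theorem huComplexReduce_refl (r M N : ℕ) : huComplexReduce X q r M (le_refl N) = 𝟙 _ := by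
  dsimp only [huComplexReduce, deRhamReductionMap]
  rw [powQuotientMap_refl]
  haveI := HomologicalComplex.mono_of_mono_f
    (powImageι (deRhamReduction X q r N) q (antitone_staircase r M)) fun _ ↦ inferInstance
  rw [← cancel_mono (powImageι (deRhamReduction X q r N) q (antitone_staircase r M)),
    powImageMap_comp_powImageι, Category.comp_id, Category.id_comp]

/-- Hu's reductions compose: `(N'' → N') ≫ (N' → N) = (N'' → N)`. [folklore] -/
theorem huComplexReduce_comp (r M : ℕ) {N N' N'' : ℕ} (h : N ≤ N') (h' : N' ≤ N'') :
    huComplexReduce X q r M h' ≫ huComplexReduce X q r M h = huComplexReduce X q r M (h.trans h') := by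
  dsimp only [huComplexReduce, deRhamReductionMap]
  rw [← powQuotientMap_comp _ q (antitone_staircase r N) (antitone_staircase r N')
    (antitone_staircase r N'') (staircase_le_staircase r h) (staircase_le_staircase r h')]
  haveI := HomologicalComplex.mono_of_mono_f
    (powImageι (deRhamReduction X q r N) q (antitone_staircase r M)) fun _ ↦ inferInstance
  rw [← cancel_mono (powImageι (deRhamReduction X q r N) q (antitone_staircase r M)), Category.assoc,
    powImageMap_comp_powImageι, powImageMap_comp_powImageι, powImageMap_comp_powImageι_assoc]

/-- The `ℤ`-indexed reduction for `N ≤ N` is the identity. [folklore] -/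
theorem huComplexIntReduce_refl (r M N : ℕ) : huComplexIntReduce X q r M (le_refl N) = 𝟙 _ := by
  dsimp only [huComplexIntReduce]
  rw [huComplexReduce_refl, HomologicalComplex.extendMap_id]

/-- The `ℤ`-indexed reductions compose. [folklore] -/
theorem huComplexIntReduce_comp (r M : ℕ) {N N' N'' : ℕ} (h : N ≤ N') (h' : N' ≤ N'') :
    huComplexIntReduce X q r M h' ≫ huComplexIntReduce X q r M h =
      huComplexIntReduce X q r M (h.trans h') := by
  dsimp only [huComplexIntReduce]
  rw [← HomologicalComplex.extendMap_comp, huComplexReduce_comp]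

end Complexes

section Hypercohomology

variable (p : ℕ) [Fact p.Prime] (k : Type) [CommRing k] (𝒳 : SchemeOver (WittVector p k))

/-- The reduction `ℍⁱ(p^{r,m}_{r,n}Ω•) → ℍⁱ(p^{r,m}_{r,n}Ω•)` for `n ≤ n` is the identity. [folklore] -/
theorem huHReduce_refl (r m n : ℕ) (i : ℤ) (x : huH p k 𝒳 r m n i) :
    huHReduce p k 𝒳 r m (le_refl n) i x = x := by
  dsimp only [huHReduce]
  rw [huComplexIntReduce_refl]
  exact HyperExt.map_id x

/-- The reductions on hypercohomology compose: `(n' → n) ∘ (n'' → n') = (n'' → n)`. [folklore] -/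
theorem huHReduce_comp (r m : ℕ) {n n' n'' : ℕ} (h : n ≤ n') (h' : n' ≤ n'') (i : ℤ)
    (x : huH p k 𝒳 r m n'' i) :
    huHReduce p k 𝒳 r m h i (huHReduce p k 𝒳 r m h' i x) = huHReduce p k 𝒳 r m (h.trans h') i x := by
  dsimp only [huHReduce]
  rw [← HyperExt.map_comp, huComplexIntReduce_comp]

variable {p k 𝒳}

/-- Components of the reduction on obstruction targets. [folklore] -/
theorem HuObstructionTarget.reduce_apply (d m : ℕ) {n n' : ℕ} (h : n ≤ n')
    (x : HuObstructionTarget p k 𝒳 d m n') (r : {r : ℕ // 1 ≤ r ∧ r < d}) :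
    HuObstructionTarget.reduce d m h x r = huHReduce p k 𝒳 r.1 m h _ (x r) :=
  rfl

/-- The reduction on obstruction targets for `n ≤ n` is the identity. [folklore] -/
theorem HuObstructionTarget.reduce_refl (d m n : ℕ) (x : HuObstructionTarget p k 𝒳 d m n) :
    HuObstructionTarget.reduce d m (le_refl n) x = x :=
  funext fun r ↦ by rw [HuObstructionTarget.reduce_apply, huHReduce_refl]

/-- The reductions on obstruction targets compose (an inverse system in `n`). [folklore] -/
theorem HuObstructionTarget.reduce_comp (d m : ℕ) {n n' n'' : ℕ} (h : n ≤ n') (h' : n' ≤ n'')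
    (x : HuObstructionTarget p k 𝒳 d m n'') :
    HuObstructionTarget.reduce d m h (HuObstructionTarget.reduce d m h' x) =
      HuObstructionTarget.reduce d m (h.trans h') x :=
  funext fun r ↦ by simp only [HuObstructionTarget.reduce_apply, huHReduce_comp]

/-- Components of the reduction on kernel sources. [folklore] -/
theorem HuKernelSource.reduce_apply (m : ℕ) {n n' : ℕ} (h : n ≤ n') (x : HuKernelSource p k 𝒳 m n')
    (r : {r : ℕ // 1 ≤ r ∧ r < p}) :
    HuKernelSource.reduce m h x r = huHReduce p k 𝒳 r.1 m h _ (x r) :=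
  rfl

/-- The reduction on kernel sources for `n ≤ n` is the identity. [folklore] -/
theorem HuKernelSource.reduce_refl (m n : ℕ) (x : HuKernelSource p k 𝒳 m n) :
    HuKernelSource.reduce m (le_refl n) x = x :=
  funext fun r ↦ by rw [HuKernelSource.reduce_apply, huHReduce_refl]

/-- The reductions on kernel sources compose (an inverse system in `n`). [folklore] -/
theorem HuKernelSource.reduce_comp (m : ℕ) {n n' n'' : ℕ} (h : n ≤ n') (h' : n' ≤ n'')
    (x : HuKernelSource p k 𝒳 m n'') :
    HuKernelSource.reduce m h (HuKernelSource.reduce m h' x) = HuKernelSource.reduce m (h.trans h') x :=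
  funext fun r ↦ by simp only [HuKernelSource.reduce_apply, huHReduce_comp]

end Hypercohomology

end Functoriality

/-! ### The long exact hypercohomology sequence of Hu's three-term sequences

`0 → p^{r,M}_{r,N}Ω• → p^{r,M'}_{r,N}Ω• → p^{r,M'}_{r,M}Ω• → 0` (`M' ≤ M ≤ N`; `Crystalline.huShortComplex`,
short exact by `Crystalline.hu_shortExact`) stays short exact after extension by zero to `ℤ`-indexed
complexes, so `huH` (hyper-Ext from the constant sheaf `ℤ`) has the long exact sequence of
`Algebra.Homology.HyperExt` (`exact₂/₃/₁_apply`, `delta`, `delta_naturality`). The connecting maps are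
written `HyperExt.delta (hu_shortExact_extend 𝒳 p r hM hN) n₀ n₁ h` (no new definition is introduced).
The short exactness of the extension and the commutation of inclusions with reductions are checked
directly here (cf. `Algebra.Homology.shortExact_map_extendFunctor`,
`Algebra.Homology.powImageLE_comp_powImageMap_eq` in `Algebra/Homology/StaircasePresentation`, a leaf
module this file does not import). -/

section LongExactSequence

universe u

section Complexes

variable {A : Type u} [CommRing A] (X : Over (Spec (CommRingCat.of A))) (q : ℤ)

/-- On the `ℤ`-indexed Hu complexes, inclusion followed by reduction vanishes:
`p^{r,M}_{r,N}Ω• → p^{r,M'}_{r,N}Ω• → p^{r,M'}_{r,M}Ω•` is zero (`M' ≤ M ≤ N`). [folklore] -/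
theorem huComplexIntLE_comp_huComplexIntReduce (r : ℕ) {M M' N : ℕ} (hM : M' ≤ M) (hN : M ≤ N) :
    huComplexIntLE X q r hM N ≫ huComplexIntReduce X q r M' hN = 0 := by
  dsimp only [huComplexIntLE, huComplexIntReduce]
  rw [← HomologicalComplex.extendMap_comp,
    show huComplexLE X q r hM N ≫ huComplexReduce X q r M' hN = 0 from
      (huShortComplex X q r hM hN).zero,
    HomologicalComplex.extendMap_zero]

/-- **Hu's three-term sequence stays short exact after extension by zero**:
`0 → p^{r,M}_{r,N}Ω• → p^{r,M'}_{r,N}Ω• → p^{r,M'}_{r,M}Ω• → 0` (`M' ≤ M ≤ N`) as `ℤ`-indexed cochain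
complexes of abelian sheaves (`Crystalline.hu_shortExact` and
`Algebra.Homology.shortExact_map_extendFunctor`). [folklore] -/
theorem hu_shortExact_extend (r : ℕ) {M M' N : ℕ} (hM : M' ≤ M) (hN : M ≤ N) :
    (ShortComplex.mk (huComplexIntLE X q r hM N) (huComplexIntReduce X q r M' hN)
      (huComplexIntLE_comp_huComplexIntReduce X q r hM hN)).ShortExact := by
  -- degreewise: the original sequence in non-negative degrees, `0 → 0 → 0` in negative degrees
  -- (cf. `Algebra.Homology.shortExact_map_extendFunctor`)
  refine HomologicalComplex.shortExact_of_degreewise_shortExact _ fun i ↦ ?_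
  by_cases hi : ∃ j : ℕ, ComplexShape.embeddingUpNat.f j = i
  · obtain ⟨j, hj⟩ := hi
    refine ShortComplex.shortExact_of_iso (ShortComplex.isoMk
      ((huComplex X q r M N).extendXIso ComplexShape.embeddingUpNat hj)
      ((huComplex X q r M' N).extendXIso ComplexShape.embeddingUpNat hj)
      ((huComplex X q r M' M).extendXIso ComplexShape.embeddingUpNat hj) ?_ ?_).symm
      ((HomologicalComplex.shortExact_iff_degreewise_shortExact _).mp (hu_shortExact X q r hM hN) j)
    · change ((huComplex X q r M N).extendXIso _ hj).hom ≫ (huComplexLE X q r hM N).f j =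
        (huComplexIntLE X q r hM N).f i ≫ ((huComplex X q r M' N).extendXIso _ hj).hom
      rw [HomologicalComplex.extendMap_f _ _ hj, Category.assoc, Category.assoc, Iso.inv_hom_id,
        Category.comp_id]
    · change ((huComplex X q r M' N).extendXIso _ hj).hom ≫ (huComplexReduce X q r M' hN).f j =
        (huComplexIntReduce X q r M' hN).f i ≫ ((huComplex X q r M' M).extendXIso _ hj).hom
      rw [HomologicalComplex.extendMap_f _ _ hj, Category.assoc, Category.assoc, Iso.inv_hom_id,
        Category.comp_id]
  · have h₀ : ∀ L : CochainComplex (Sheaf (Opens.grothendieckTopology X.left) AddCommGrpCat.{u}) ℕ,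
        Limits.IsZero ((L.extend ComplexShape.embeddingUpNat).X i) :=
      fun L ↦ L.isZero_extend_X _ i fun j hj ↦ hi ⟨j, hj⟩
    exact { exact := ShortComplex.exact_of_isZero_X₂ _ (h₀ _)
            mono_f := (h₀ (huComplex X q r M N)).mono _
            epi_g := (h₀ (huComplex X q r M' M)).epi _ }

/-- Inclusions and reductions of Hu's complexes commute: for `M' ≤ M` and `N ≤ N'`,
`(p^{r,M}_{r,N'} ⊆ p^{r,M'}_{r,N'}) ≫ (N' → N) = (N' → N) ≫ (p^{r,M}_{r,N} ⊆ p^{r,M'}_{r,N})`. [folklore] -/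
@[reassoc]
theorem huComplexLE_comp_huComplexReduce (r : ℕ) {M M' N N' : ℕ} (hM : M' ≤ M) (h : N ≤ N') :
    huComplexLE X q r hM N' ≫ huComplexReduce X q r M' h =
      huComplexReduce X q r M h ≫ huComplexLE X q r hM N := by
  -- checked after the degreewise-mono inclusion into `Ω•/q^{(r-•)N}`
  -- (cf. `Algebra.Homology.powImageLE_comp_powImageMap_eq`)
  haveI := HomologicalComplex.mono_of_mono_f (huComplexι X q r M' N) fun _ ↦ inferInstance
  rw [← cancel_mono (huComplexι X q r M' N), Category.assoc, Category.assoc,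
    huComplexReduce_comp_huComplexι, huComplexLE_comp_huComplexι, huComplexReduce_comp_huComplexι,
    ← Category.assoc, huComplexLE_comp_huComplexι]

/-- The same on the `ℤ`-indexed complexes. [folklore] -/
@[reassoc]
theorem huComplexIntLE_comp_huComplexIntReduce' (r : ℕ) {M M' N N' : ℕ} (hM : M' ≤ M)
    (h : N ≤ N') :
    huComplexIntLE X q r hM N' ≫ huComplexIntReduce X q r M' h =
      huComplexIntReduce X q r M h ≫ huComplexIntLE X q r hM N := by
  dsimp only [huComplexIntLE, huComplexIntReduce]
  rw [← HomologicalComplex.extendMap_comp, ← HomologicalComplex.extendMap_comp,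
    huComplexLE_comp_huComplexReduce]

end Complexes

section Hypercohomology

-- `HasHyperExt ℤ (p^{r,M}_{r,N}Ω•)` is found through `IsStrictlyGE 0 ⇒ IsGE 0` and the
-- shift/localization instances; the default budget is too small (cf. `Crystalline/HodgeDeRhamDegeneration`).
set_option synthInstance.maxHeartbeats 200000

variable (p : ℕ) [Fact p.Prime] (k : Type) [CommRing k] (𝒳 : SchemeOver (WittVector p k))

/-- **Exactness at the middle term**: `ℍⁱ(p^{r,M}_{r,N}Ω•) → ℍⁱ(p^{r,M'}_{r,N}Ω•) → ℍⁱ(p^{r,M'}_{r,M}Ω•)`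
is exact (`M' ≤ M ≤ N`; the second map is the reduction `huHReduce`). [folklore] -/
theorem huH_exact₂ (r : ℕ) {M M' N : ℕ} (hM : M' ≤ M) (hN : M ≤ N) (i : ℤ) :
    Function.Exact
      (HyperExt.map (huComplexIntLE 𝒳 (p : ℤ) r hM N) i : huH p k 𝒳 r M N i →+ huH p k 𝒳 r M' N i)
      (huHReduce p k 𝒳 r M' hN i) :=
  HyperExt.exact₂_apply (constantSheafInt _) (hu_shortExact_extend 𝒳 (p : ℤ) r hM hN) i

/-- **Exactness at the third term**: `ℍ^{n₀}(p^{r,M'}_{r,N}Ω•) → ℍ^{n₀}(p^{r,M'}_{r,M}Ω•) →δ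
ℍ^{n₁}(p^{r,M}_{r,N}Ω•)` is exact (`n₀ + 1 = n₁`): a class at level `M` lifts to level `N` iff its
connecting image vanishes. [folklore] -/
theorem huH_exact₃ (r : ℕ) {M M' N : ℕ} (hM : M' ≤ M) (hN : M ≤ N) (n₀ n₁ : ℤ) (h : n₀ + 1 = n₁) :
    Function.Exact (huHReduce p k 𝒳 r M' hN n₀ : huH p k 𝒳 r M' N n₀ →+ huH p k 𝒳 r M' M n₀)
      (HyperExt.delta (hu_shortExact_extend 𝒳 (p : ℤ) r hM hN) n₀ n₁ h) :=
  HyperExt.exact₃_apply (constantSheafInt _) (hu_shortExact_extend 𝒳 (p : ℤ) r hM hN) n₀ n₁ h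

/-- **Exactness at the first term**: `ℍ^{n₀}(p^{r,M'}_{r,M}Ω•) →δ ℍ^{n₁}(p^{r,M}_{r,N}Ω•) →
ℍ^{n₁}(p^{r,M'}_{r,N}Ω•)` is exact (`n₀ + 1 = n₁`). [folklore] -/
theorem huH_exact₁ (r : ℕ) {M M' N : ℕ} (hM : M' ≤ M) (hN : M ≤ N) (n₀ n₁ : ℤ) (h : n₀ + 1 = n₁) :
    Function.Exact (HyperExt.delta (hu_shortExact_extend 𝒳 (p : ℤ) r hM hN) n₀ n₁ h)
      (HyperExt.map (huComplexIntLE 𝒳 (p : ℤ) r hM N) n₁ :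
        huH p k 𝒳 r M N n₁ →+ huH p k 𝒳 r M' N n₁) :=
  HyperExt.exact₁_apply (constantSheafInt _) (hu_shortExact_extend 𝒳 (p : ℤ) r hM hN) n₀ n₁ h

/-- **Lifting criterion along `N → M` in hypercohomology**: the reduction
`ℍ^{n₀}(p^{r,M'}_{r,N}Ω•) → ℍ^{n₀}(p^{r,M'}_{r,M}Ω•)` is onto iff the connecting map
`δ : ℍ^{n₀}(p^{r,M'}_{r,M}Ω•) → ℍ^{n₁}(p^{r,M}_{r,N}Ω•)` vanishes identically (`n₀ + 1 = n₁`; from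
`huH_exact₃`). [folklore] -/
theorem huHReduce_surjective_iff_delta_eq_zero (r : ℕ) {M M' N : ℕ} (hM : M' ≤ M) (hN : M ≤ N)
    (n₀ n₁ : ℤ) (h : n₀ + 1 = n₁) :
    Function.Surjective (huHReduce p k 𝒳 r M' hN n₀ : huH p k 𝒳 r M' N n₀ →+ huH p k 𝒳 r M' M n₀) ↔
      ∀ y : huH p k 𝒳 r M' M n₀,
        HyperExt.delta (hu_shortExact_extend 𝒳 (p : ℤ) r hM hN) n₀ n₁ h y = 0 :=
  ⟨fun hs y ↦ (huH_exact₃ p k 𝒳 r hM hN n₀ n₁ h y).mpr (Set.mem_range.mpr (hs y)),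
    fun h0 y ↦ Set.mem_range.mp ((huH_exact₃ p k 𝒳 r hM hN n₀ n₁ h y).mp (h0 y))⟩

/-- **Four-term consequence** (the shape in which the surjectivity of the odd transitions of the
Hu tower is checked): the reduction `ℍ^{n₀}(p^{r,M'}_{r,N}Ω•) → ℍ^{n₀}(p^{r,M'}_{r,M}Ω•)` is onto iff
the map `ℍ^{n₁}(p^{r,M}_{r,N}Ω•) → ℍ^{n₁}(p^{r,M'}_{r,N}Ω•)` induced by the inclusion is injective
(`n₀ + 1 = n₁`; from `huH_exact₃` and `huH_exact₁`). [folklore] -/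
theorem huHReduce_surjective_iff_map_injective (r : ℕ) {M M' N : ℕ} (hM : M' ≤ M) (hN : M ≤ N)
    (n₀ n₁ : ℤ) (h : n₀ + 1 = n₁) :
    Function.Surjective (huHReduce p k 𝒳 r M' hN n₀ : huH p k 𝒳 r M' N n₀ →+ huH p k 𝒳 r M' M n₀) ↔
      Function.Injective (HyperExt.map (huComplexIntLE 𝒳 (p : ℤ) r hM N) n₁ :
        huH p k 𝒳 r M N n₁ →+ huH p k 𝒳 r M' N n₁) := by
  rw [huHReduce_surjective_iff_delta_eq_zero p k 𝒳 r hM hN n₀ n₁ h, injective_iff_map_eq_zero]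
  refine ⟨fun h0 a ha ↦ ?_,
    fun hinj y ↦ hinj _ ((huH_exact₁ p k 𝒳 r hM hN n₀ n₁ h).apply_apply_eq_zero y)⟩
  obtain ⟨y, hy⟩ := Set.mem_range.mp ((huH_exact₁ p k 𝒳 r hM hN n₀ n₁ h a).mp ha)
  rw [← hy]
  exact h0 y

/-- **Vanishing above the amplitude**: on a space of cohomological dimension `≤ c`
(`Crystalline.HasCohomologicalDimensionLE`; e.g. a noetherian space of Krull dimension `≤ c`,
`Crystalline.hasCohomologicalDimensionLE_of_noetherianSpace`), `ℍⁱ(p^{r,M}_{r,N}Ω•) = 0` for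
`i > (r − 1) + c`, the complex being concentrated in degrees `[0, r − 1]`
(`Crystalline.isStrictlyLE_huComplexInt`, `Crystalline.sheafHypercohomology_eq_zero`). In the proof of
Prop. 11.1 of arXiv:2507.12458 this is the vanishing of the summands `r ≥ d + i` (there on `|X_1|`,
`c = d`; on `|𝒳|`, where the tree takes hypercohomology, `c = d + 1` — caveat (β)). [folklore] -/
theorem huH_eq_zero_of_lt (c : ℕ) [HasCohomologicalDimensionLE (Opens.grothendieckTopology 𝒳.left) c]
    (r M N : ℕ) {i : ℤ} (hi : (r : ℤ) - 1 + c < i) (x : huH p k 𝒳 r M N i) : x = 0 :=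
  sheafHypercohomology_eq_zero c _ 0 ((r : ℤ) - 1) hi x

/-- **Vanishing in negative degrees**: `ℍⁱ(p^{r,M}_{r,N}Ω•) = 0` for `i < 0`. [folklore] -/
theorem huH_eq_zero_of_neg (r M N : ℕ) {i : ℤ} (hi : i < 0) (x : huH p k 𝒳 r M N i) : x = 0 :=
  sheafHypercohomology_eq_zero_of_lt _ 0 hi x

/-- **Naturality of the connecting maps in the level `N`**: for `M' ≤ M ≤ N ≤ N'` and
`x ∈ ℍ^{n₀}(p^{r,M'}_{r,M}Ω•)`, the connecting image of `x` for the level-`N` sequence is the reduction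
`N' → N` of its connecting image for the level-`N'` sequence (the morphism of short exact sequences
`(N' → N, N' → N, 𝟙)` and `HyperExt.delta_naturality`). [folklore] -/
theorem huHδ_naturality (r : ℕ) {M M' N N' : ℕ} (hM : M' ≤ M) (hN : M ≤ N) (hNN' : N ≤ N')
    (n₀ n₁ : ℤ) (h : n₀ + 1 = n₁) (x : huH p k 𝒳 r M' M n₀) :
    HyperExt.delta (hu_shortExact_extend 𝒳 (p : ℤ) r hM hN) n₀ n₁ h x =
      huHReduce p k 𝒳 r M hNN' n₁
        (HyperExt.delta (hu_shortExact_extend 𝒳 (p : ℤ) r hM (hN.trans hNN')) n₀ n₁ h x) := by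
  -- the morphism of short complexes from level `N'` to level `N`
  let φ : ShortComplex.mk (huComplexIntLE 𝒳 (p : ℤ) r hM N') (huComplexIntReduce 𝒳 (p : ℤ) r M'
        (hN.trans hNN')) (huComplexIntLE_comp_huComplexIntReduce 𝒳 (p : ℤ) r hM (hN.trans hNN')) ⟶
      ShortComplex.mk (huComplexIntLE 𝒳 (p : ℤ) r hM N) (huComplexIntReduce 𝒳 (p : ℤ) r M' hN)
        (huComplexIntLE_comp_huComplexIntReduce 𝒳 (p : ℤ) r hM hN) :=
    { τ₁ := huComplexIntReduce 𝒳 (p : ℤ) r M hNN'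
      τ₂ := huComplexIntReduce 𝒳 (p : ℤ) r M' hNN'
      τ₃ := 𝟙 _
      comm₁₂ := (huComplexIntLE_comp_huComplexIntReduce' 𝒳 (p : ℤ) r hM hNN').symm
      comm₂₃ := by
        change huComplexIntReduce 𝒳 (p : ℤ) r M' hNN' ≫ huComplexIntReduce 𝒳 (p : ℤ) r M' hN =
          huComplexIntReduce 𝒳 (p : ℤ) r M' (hN.trans hNN') ≫ 𝟙 _
        rw [Category.comp_id, huComplexIntReduce_comp] }
  have hx : HyperExt.map φ.τ₃ n₀ x = x := HyperExt.map_id x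
  conv_lhs => rw [← hx]
  exact HyperExt.delta_naturality (hu_shortExact_extend 𝒳 (p : ℤ) r hM (hN.trans hNN'))
    (hu_shortExact_extend 𝒳 (p : ℤ) r hM hN) φ n₀ n₁ h x

end Hypercohomology

end LongExactSequence

end Literature.AlgebraicGeometry.KTheory

end
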